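import Summits.Ventures.PercRepro2.CaseOnePocketMoves

/-!
# A worked example of the pocket reduction: `a₃` in a `K₄` hanging at the root `a₁`
(blind cell PercRepro2, p1 g27)

The graph on seven vertices `o = 0, a₁ = 1, a₂ = 2, b = 3, a₃ = 4` and the unmarked `5, 6`: the square
`0–1–2–3–0` outside, and the complete graph `K₄` on `{1, 4, 5, 6}` hanging at the root `1`. The pocket
`W = {4, 5, 6}` at the cut vertex `1` is mark-free and contains the statement vertex `4`, so
`closedAt_of_pocket_at_mark` gives the four case-1 forms at `4` for EVERY weight vector
(`closedAt_k4`), hence `(J1₁)`. The `K₄` is not series–parallel: no sequence of the moves of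
`CaseOneMoves` (leaf, series, parallel, loop, pendant step) reaches this instance from a closed anchor;
the pocket step does in one move. Own code; standard axioms. -/

namespace Summit.Ventures.PercRepro2

namespace CaseOne

namespace PocketExample

/-- The ends of the ten edges: the square `0–1–2–3–0` (edges `0`–`3`) and the `K₄` on `{1, 4, 5, 6}`
(edges `4`–`9`). -/
def ends : Fin 10 → Sym2 (Fin 7) :=
  ![s(0, 1), s(1, 2), s(2, 3), s(0, 3), s(1, 4), s(1, 5), s(1, 6), s(4, 5), s(4, 6), s(5, 6)]

/-- The interior of the pocket: the three `K₄` vertices other than the root. -/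
def W : Set (Fin 7) := ↑({4, 5, 6} : Finset (Fin 7))

/-- The edges of the pocket: the six `K₄` edges. -/
def P : Finset (Fin 10) := {4, 5, 6, 7, 8, 9}

/-- `(W, 1, P)` is a pocket of the graph. -/
theorem isPocket : IsPocket ends W 1 P where
  x_not_mem := by simp [W]
  mem_iff := by
    intro e
    simp only [W, Finset.mem_coe]
    revert e
    decide
  ends_mem := by
    intro e he y hy
    simp only [W, Finset.mem_coe]
    revert e y
    decide

/-- **The four case-1 forms at the `K₄` vertex `4` hold for every weight vector** (over `ℚ`; the proof
is the pocket reduction at the mark `a₁ = 1`). -/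
theorem closedAt_k4 : ClosedAt ℚ 0 1 2 3 (Fin 10) ends 4 :=
  closedAt_of_pocket_at_mark 0 1 2 3 isPocket (he := (by decide : (4 : Fin 10) ∈ P))
    (by simp [W]) (by simp [W]) (by simp [W]) (by simp [W]) (by simp [W]) (Or.inr (Or.inl rfl))

/-- `(J1₁)` at the `K₄` vertex `4` for every weight vector. -/
theorem jOneOne_k4 (p : Fin 10 → ℚ) (hp : IsProbVec p) : JOneOne p ends 0 1 2 4 3 :=
  FourForms.jOneOne (closedAt_k4 p hp)

end PocketExample

end CaseOne

end Summit.Ventures.PercRepro2
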